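import Literature.AlgebraicGeometry.HodgeTheory.AbelianVarietyRingActionHomologyLattice
import Literature.RingTheory.DedekindDomain.ModuleRankOverRingOfIntegers
import Literature.RingTheory.DedekindDomain.BlockIdempotentFixedPoints
import Literature.RingTheory.DedekindDomain.ProjectiveModuleTorsionQuotient
import HarnessLib

/-!
# The `e_w`-count on a complex abelian variety with `𝒪_F`-multiplication:
# `#{P ∈ A[pⁿ](ℂ) ∕∕ ι₀(a_n)·P = P} = p^{n·2ef}` when `dim A = [F : ℚ]`

Topic `Literature/AlgebraicGeometry/HodgeTheory`; namespace `Literature.AlgebraicGeometry.HodgeTheory.AbelianVariety`.  THEOREMS ONLY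
(no definition, no named fact, no instance, no notation, no `sorry`).  Cell `hodgecm-mathlib` (D-0151), FLOOR 0, P6 «MOD programme»
(crux hLiu418 = stmt-HodgeConjecture-24832, `--supports`): FILE 3 (junction) of the GEN organ **(S-H-A) «TATE∕BETTI-MODULE COMPARISON
FOR THE `e_w`-COUNT»** (K∕BT desk F0P6d-plan (g2) cut v2.3 §2, socket (S-H) `hrank`; A-p18 (g30), 2026-09-01).  It joins ★ FILE 1
`ModuleRankOverRingOfIntegers` (`rank_ℤ = [F:ℚ] · rank_{𝒪_F}`, torsion-free ⇒ projective), ★ FILE 2 `AbelianVarietyRingActionHomologyLattice`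
(`Λ = H₁(A(ℂ); ℤ)` as an `𝒪_F`-module; `#{P ∈ A[N](ℂ) fixed by ι₀(a)} = #{y ∈ Λ∕(N)Λ ∕∕ a • y = y}`), ★ DEAL 8 `ProjectiveModuleTorsionQuotient`
(`Λ ∕ pⁿΛ ≃ₗ[𝒪_F] (𝒪_F ∕ pⁿ)^m` for `Λ` finite projective of rank `m`) and ★ DEAL 7 `BlockIdempotentFixedPoints` (the fixed points of the block
idempotent `a_n` on `(𝒪_F ∕ pⁿ)^2` number `p^{n·2ef}`):

* §1 `Λ` IS A FINITE PROJECTIVE `𝒪_F`-MODULE OF RANK `2 dim A ∕ [F : ℚ]`: `projective_hOne`, **`finrank_rat_mul_finrank_hOne`**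
  (`[F : ℚ] · rank_{𝒪_F} Λ = 2 dim A`), `finrank_hOne_eq_two` (`= 2` when `dim A = [F : ℚ]` — the unitary-Shimura-curve case: an abelian
  variety of dimension `[F : ℚ]` with `𝒪_F`-multiplication), `nonempty_hOne_quotient_pow_linearEquiv_pi` (`Λ ∕ pⁿΛ ≃ₗ[𝒪_F] (𝒪_F ∕ pⁿ)^2`).
* §2 THE COMPLEX `e_w`-COUNT **`natCard_fixedPoints_torsionPoints_blockIdempotent`**: for `w ∣ p` a prime of `𝒪_F` with `#(𝒪_F ∕ w) = p^f`,
  `(p) = w^e · 𝔟`, `w ⊔ 𝔟 = ⊤`, and a block family `a_n ≡ 1 (w^{en})`, `a_n ≡ 0 (𝔟ⁿ)` (★ `BlockIdempotentFamily`):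
  `#{P ∈ A[pⁿ](ℂ) ∕∕ ι₀(a_n)·P = P} = p ^ (n * (2 * e * f))` — the socket (S-H)'s `hcount` over `ℂ` (★ DEAL 9 v2 `TorsionSectionsPointsCount`
  §4 turns such a count at a geometric point `Ω` of characteristic `0` into the block height `2ef` of the `w`-block of `A[p^∞]`).
  The passage `Ω ↔ ℂ` for `A` over a field embedded in both is ★ `Motives/AbelianVarietyTateModuleAlong` §1∕§3 and is made at the record
  junction, not here.

RANK IS FREE OF CHARGE: `Λ ⊗ ℚ` is a vector space over the FIELD `F`, whence `[F:ℚ] ∣ 2 dim A` and `rank_{𝒪_F} Λ = 2 dim A ∕ [F:ℚ]` with no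
condition on the action (no Kottwitz signature, no rationality of characteristic polynomials).  HC_CM is proved only modulo the printed
citations until rung 0 closes; this file is generic and changes no count.

THE PRINT.  [Shimura1998] §3.1–§3.2 (a lattice in `ℂⁿ` stable under an order of `F` with `2n = m[F:ℚ]` is a projective `𝔬`-module of rank `m`),
§7.1 (`𝔤(𝔞, A) ≅ 𝔬∕𝔞`-structure of ideal-section points); [Mumford1970] §24 p. 237 and [RapoportSmithlingZhang2020Diagonal] §4.1 (p. 17)
(`A[p^∞] = ∏_{w∣p} A[w^∞]`, the `w`-block of height `n·[F_w : ℚ_p]` for `T_p A` free of rank `n` over `𝒪_F ⊗ ℤ_p`; here `n = 2`).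

## References
* [Shimura1998] G. Shimura, *Abelian Varieties with Complex Multiplication and Modular Functions* (1998), §3.1–§3.2, §7.1.
* [MumfordAV1970] D. Mumford, *Abelian Varieties* (1970), §24 p. 237 (`A[n] ≅ (ℤ∕n)^{2g}`, `T_ℓ = H₁ ⊗ ℤ_ℓ` over `ℂ`).
* [RapoportSmithlingZhang2020Diagonal] M. Rapoport, B. Smithling, W. Zhang, *Arithmetic diagonal cycles on unitary Shimura varieties*,
  Compos. Math. 156 (2020), §4.1 (p. 17).
-/

set_option autoImplicit false

noncomputable section

open CategoryTheory Module Function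
open Literature.AlgebraicTopology.SingularHomology
open Literature.RingTheory.DedekindDomain

namespace Literature.AlgebraicGeometry.HodgeTheory

namespace AbelianVariety

open Literature.AlgebraicGeometry.Motives Literature.AlgebraicGeometry.Motives.AbelianVariety
open NumberField

variable {A : Motives.AbelianVariety ℂ} {F : Type} [Field F] [NumberField F]

/-! ## §1 `Λ = H₁(A(ℂ); ℤ)` is a finite projective `𝒪_F`-module of rank `2 dim A ∕ [F : ℚ]` -/

/-- **`Λ = H₁(A(ℂ); ℤ)` is a projective `𝒪_F`-module** (finitely generated and without `ℤ`-torsion over the Dedekind domain `𝒪_F`;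
★ `projective_of_isTorsionFree_int`).  The `ℤ`-torsion-freeness is moved from the homology object's own `ℤ`-module structure (free,
★ `free_singularHomology_int`) to the `zsmul` structure that ★ FILE 1 speaks (`int_smul_eq_zsmul`). [cite: Shimura1998, §3.1–§3.2] -/
theorem projective_hOne (ι₀ : 𝓞 F →+* End A) :
    letI : Module (𝓞 F) (singularHomology ℤ ℤ (A.Points ℂ) 1) :=
      Module.compHom _ ((RingHom.mk' (hOneRep A) hOneRep_add).comp ι₀)
    Module.Projective (𝓞 F) (singularHomology ℤ ℤ (A.Points ℂ) 1) := by
  letI : Module (𝓞 F) (singularHomology ℤ ℤ (A.Points ℂ) 1) :=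
    Module.compHom _ ((RingHom.mk' (hOneRep A) hOneRep_add).comp ι₀)
  haveI := finite_hOne ι₀
  haveI : Module.Free ℤ (singularHomology ℤ ℤ (A.Points ℂ) 1) := free_singularHomology_int A 1
  haveI : @Module.IsTorsionFree ℤ (singularHomology ℤ ℤ (A.Points ℂ) 1) _ _ (AddCommGroup.toIntModule _) := by
    refine @Module.IsTorsionFree.mk ℤ (singularHomology ℤ ℤ (A.Points ℂ) 1) _ _ (AddCommGroup.toIntModule _)
      fun r hr x y hxy => ?_
    apply hr.isSMulRegular (M := singularHomology ℤ ℤ (A.Points ℂ) 1)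
    exact (int_smul_eq_zsmul _ r x).trans ((id hxy : r • x = r • y).trans (int_smul_eq_zsmul _ r y).symm)
  exact projective_of_isTorsionFree_int (F := F) _

/-- **`[F : ℚ] · rank_{𝒪_F} Λ = 2 dim A`** (★ `finrank_int_eq_finrank_rat_mul_finrank` with `rank_ℤ H₁(A(ℂ); ℤ) = 2 dim A`,
★ `finrank_singularHomology_int_one`): `Λ ⊗ ℚ` is an `F`-vector space.  In particular `[F : ℚ] ∣ 2 dim A`. [cite: Shimura1998, §3.1–§3.2] -/
theorem finrank_rat_mul_finrank_hOne (ι₀ : 𝓞 F →+* End A) :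
    letI : Module (𝓞 F) (singularHomology ℤ ℤ (A.Points ℂ) 1) :=
      Module.compHom _ ((RingHom.mk' (hOneRep A) hOneRep_add).comp ι₀)
    Module.finrank ℚ F * Module.finrank (𝓞 F) (singularHomology ℤ ℤ (A.Points ℂ) 1) = 2 * A.dim := by
  letI : Module (𝓞 F) (singularHomology ℤ ℤ (A.Points ℂ) 1) :=
    Module.compHom _ ((RingHom.mk' (hOneRep A) hOneRep_add).comp ι₀)
  rw [← finrank_int_eq_finrank_rat_mul_finrank (F := F) (singularHomology ℤ ℤ (A.Points ℂ) 1)]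
  convert finrank_singularHomology_int_one A using 2
  exact Subsingleton.elim _ _

/-- **`rank_{𝒪_F} Λ = 2` when `dim A = [F : ℚ]`** (an abelian variety of dimension `[F : ℚ]` with `𝒪_F`-multiplication, e.g. the abelian
surfaces-with-`𝒪_F`-structure of the unitary Shimura CURVE: `T A` free of rank `2`). [cite: Shimura1998, §3.1–§3.2]
[cite: RapoportSmithlingZhang2020Diagonal, §4.1 (p. 17)] -/
theorem finrank_hOne_eq_two (ι₀ : 𝓞 F →+* End A) (hdim : Module.finrank ℚ F = A.dim) :
    letI : Module (𝓞 F) (singularHomology ℤ ℤ (A.Points ℂ) 1) :=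
      Module.compHom _ ((RingHom.mk' (hOneRep A) hOneRep_add).comp ι₀)
    Module.finrank (𝓞 F) (singularHomology ℤ ℤ (A.Points ℂ) 1) = 2 := by
  letI : Module (𝓞 F) (singularHomology ℤ ℤ (A.Points ℂ) 1) :=
    Module.compHom _ ((RingHom.mk' (hOneRep A) hOneRep_add).comp ι₀)
  have h := finrank_rat_mul_finrank_hOne ι₀
  rw [hdim, mul_comm 2] at h
  exact Nat.eq_of_mul_eq_mul_left (hdim ▸ Module.finrank_pos) h

/-- **`Λ ∕ pⁿΛ ≃ₗ[𝒪_F] (𝒪_F ∕ pⁿ)^2`** when `dim A = [F : ℚ]` (★ DEAL 8 `nonempty_quotient_pow_linearEquiv_pi` at rank `2`).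
[cite: Shimura1998, §3.1–§3.2] [cite: RapoportSmithlingZhang2020Diagonal, §4.1 (p. 17)] -/
theorem nonempty_hOne_quotient_pow_linearEquiv_pi (ι₀ : 𝓞 F →+* End A) (hdim : Module.finrank ℚ F = A.dim) (p n : ℕ) (hp : p ≠ 0) :
    letI : Module (𝓞 F) (singularHomology ℤ ℤ (A.Points ℂ) 1) :=
      Module.compHom _ ((RingHom.mk' (hOneRep A) hOneRep_add).comp ι₀)
    Nonempty ((singularHomology ℤ ℤ (A.Points ℂ) 1 ⧸ (Ideal.span {((p : 𝓞 F) ^ n)} •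
        (⊤ : Submodule (𝓞 F) (singularHomology ℤ ℤ (A.Points ℂ) 1)))) ≃ₗ[𝓞 F]
      (Fin 2 → 𝓞 F ⧸ Ideal.span {((p : 𝓞 F) ^ n)})) := by
  letI : Module (𝓞 F) (singularHomology ℤ ℤ (A.Points ℂ) 1) :=
    Module.compHom _ ((RingHom.mk' (hOneRep A) hOneRep_add).comp ι₀)
  haveI := finite_hOne ι₀
  haveI := projective_hOne ι₀
  exact ProjectiveTorsionQuotient.nonempty_quotient_pow_linearEquiv_pi (𝓞 F) _ (finrank_hOne_eq_two ι₀ hdim) p n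
    (by exact_mod_cast hp)

/-! ## §2 The complex `e_w`-count -/

/-- **THE COMPLEX `e_w`-COUNT: `#{P ∈ A[pⁿ](ℂ) ∕∕ ι₀(a_n)·P = P} = p ^ (n · 2ef)`** for a complex abelian variety `A` of dimension
`[F : ℚ]` with `𝒪_F`-multiplication `ι₀`, a non-zero prime `w` of `𝒪_F` with `#(𝒪_F ∕ w) = p^f`, `(p) = w^e·𝔟`, `w ⊔ 𝔟 = ⊤`, and a block
idempotent family `a` (`a_n ≡ 1 mod w^{en}`, `a_n ≡ 0 mod 𝔟ⁿ`; ★ `exists_blockIdempotentFamily`): the points of `A[pⁿ](ℂ)` fixed by `ι₀(a_n)`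
are the `w`-block `Λ∕pⁿΛ ⊗ 𝒪_F∕w^{en} ≅ (𝒪_F∕w^{en})²`, of order `(p^f)^{2en}`.  Chain: ★ FILE 2 `natCard_fixedPoints_torsionPoints_eq` → ★ DEAL 8
at rank `2` (§1) → ★ DEAL 7 `natCard_fixedPoints_smul_of_linearEquiv_two`.  The exponent is written `n * (2 * e * f)` = the (S-H) token
`h₁ := 2 * e * f` of ★ `hrank_pDivisibleGroup_of_natCard_fixedPoints` ∕ ★ DEAL 9 v2 §4.
[cite: RapoportSmithlingZhang2020Diagonal, §4.1 (p. 17)] [cite: Shimura1998, §7.1] -/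
theorem natCard_fixedPoints_torsionPoints_blockIdempotent (ι₀ : 𝓞 F →+* End A) (hdim : Module.finrank ℚ F = A.dim)
    {p : ℕ} (w : Ideal (𝓞 F)) [w.IsMaximal] (hw0 : w ≠ ⊥) {f : ℕ} (hf : Nat.card (𝓞 F ⧸ w) = p ^ f)
    {e : ℕ} {𝔟 : Ideal (𝓞 F)} (hx : Ideal.span {(p : 𝓞 F)} = w ^ e * 𝔟) (hcop : w ⊔ 𝔟 = ⊤)
    (a : ℕ → 𝓞 F) (ha1 : ∀ n, a n - 1 ∈ w ^ (e * n)) (ha2 : ∀ n, a n ∈ 𝔟 ^ n) (hp : p ≠ 0) (n : ℕ) :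
    Nat.card {P : A.torsionPoints ℂ ((p ^ n : ℕ) : ℤ) //
        IsMonHom.monoidHom (End.asHom (ι₀ (a n))).hom.hom.hom (specOver ℂ ℂ) (P : A.Points ℂ) = P} =
      p ^ (n * (2 * e * f)) := by
  letI : Module (𝓞 F) (singularHomology ℤ ℤ (A.Points ℂ) 1) :=
    Module.compHom _ ((RingHom.mk' (hOneRep A) hOneRep_add).comp ι₀)
  rw [natCard_fixedPoints_torsionPoints_eq ι₀ (a n) (p ^ n) (pow_ne_zero n hp), Nat.cast_pow]
  obtain ⟨ε⟩ := nonempty_hOne_quotient_pow_linearEquiv_pi ι₀ hdim p n hp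
  exact natCard_fixedPoints_smul_of_linearEquiv_two w hw0 hf hx hcop a ha1 ha2 n ε

end AbelianVariety

end Literature.AlgebraicGeometry.HodgeTheory
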